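import Literature.NumberTheory.LFunctions.KMVMomentsToHalfEdge
import Literature.NumberTheory.LFunctions.KMVFirstMomentBeyondDiagonal
import HarnessLib

/-!
# Route `PrimeLevelFamEdge`, crux K_A `MomentsBeyondDiagonal` (stmt-Parity-20007), line «petersson_layers» v4:
# the MOLLIFIER-SIDE coefficients of a regrouped layer form — their `ℓ²(box)` size

In the `k`-th separated form of a truncated Petersson layer block (`…LayersTruncatedBlock`) the mollifier-side table is
`A(m₁, m₂) = x_{d₁m₁} x_{d₂m₂} · (√m₁)^{2k+1}(√m₂)^{2k+1}`, `x_m = KMV2000.mollifierCoeff P M m` (`M = q̂^{Δ'}`, `dᵢmᵢ ≤ M`).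
From the tree's `KMV2000.abs_mollifierCoeff_le` (`|x_m| ≤ ‖P‖_{∞,[0,1]} m^{−1/2}`):
* `norm_mollifierPair_le` — `‖A(m₁,m₂)‖ ≤ B_P² (d₁d₂)^{−1/2} (m₁m₂)^k`;
* `norm_sq_sum_mollifierPair_le` — `Σ_{m₁≤X₁, m₂≤X₂} ‖A(m₁,m₂)‖² ≤ B_P⁴ (d₁d₂)⁻¹ X₁^{2k+1} X₂^{2k+1}`,
the input `‖A‖₂` of `…LayersBlockFourierBound` / `…LayersBlockPascadiBound` (through `…LayersConvolutionL2`).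
Proof only (def-free helper toward `stub_farP` / `stub_band`); nothing about any layer, K_A or Landau–Siegel zeros is claimed.
-/

noncomputable section

open Finset Polynomial
open Literature.NumberTheory.LFunctions

namespace Summit.Parity.GeneralizedHardyLittlewood.Theorems.MomentsBeyondDiagonal.Layers

/-- `|x_{dm}|·(√m)^{2k+1} ≤ B · d^{−1/2} · m^k` for `1 ≤ m`, `1 ≤ d`, `dm ≤ M` (`|x_{dm}| ≤ B (dm)^{−1/2}`).
[cite: KowalskiMichelVanderKam2000, (8)–(9)] -/
theorem abs_mollifierCoeff_mul_sqrt_pow_le {P : ℝ[X]} {B : ℝ} (hB : ∀ t ∈ Set.Icc (0 : ℝ) 1, |P.eval t| ≤ B)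
    {M : ℝ} (hM : 1 < M) {d m : ℕ} (hd : 0 < d) (hm : 0 < m) (hdm : d * m ≤ ⌊M⌋₊) (k : ℕ) :
    |KMV2000.mollifierCoeff P M (d * m)| * Real.sqrt m ^ (2 * k + 1) ≤
      B * (d : ℝ) ^ (-(1 / 2 : ℝ)) * (m : ℝ) ^ k := by
  have hmem : d * m ∈ Icc 1 ⌊M⌋₊ := mem_Icc.mpr ⟨Nat.mul_pos hd hm, hdm⟩
  have hx : |KMV2000.mollifierCoeff P M (d * m)| ≤ B * (((d * m : ℕ)) : ℝ) ^ (-(1 / 2 : ℝ)) := by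
    unfold KMV2000.mollifierCoeff
    exact KMV2000.abs_mollifierCoeff_le hB hM hmem
  have hB0 : 0 ≤ B := le_trans (abs_nonneg _) (hB 0 (by simp))
  have hd0 : (0 : ℝ) < d := by exact_mod_cast hd
  have hm0 : (0 : ℝ) < m := by exact_mod_cast hm
  have hsq : Real.sqrt m ^ (2 * k + 1) = (m : ℝ) ^ k * Real.sqrt m := by
    rw [pow_succ, pow_mul, Real.sq_sqrt hm0.le]
  have hprod : (((d * m : ℕ)) : ℝ) ^ (-(1 / 2 : ℝ)) * Real.sqrt m = (d : ℝ) ^ (-(1 / 2 : ℝ)) := by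
    rw [Nat.cast_mul, Real.mul_rpow hd0.le hm0.le, Real.sqrt_eq_rpow, mul_assoc, ← Real.rpow_add hm0]
    norm_num
  calc |KMV2000.mollifierCoeff P M (d * m)| * Real.sqrt m ^ (2 * k + 1)
      ≤ B * (((d * m : ℕ)) : ℝ) ^ (-(1 / 2 : ℝ)) * Real.sqrt m ^ (2 * k + 1) :=
        mul_le_mul_of_nonneg_right hx (pow_nonneg (Real.sqrt_nonneg _) _)
    _ = B * (d : ℝ) ^ (-(1 / 2 : ℝ)) * (m : ℝ) ^ k := by
        rw [hsq, show B * (((d * m : ℕ)) : ℝ) ^ (-(1 / 2 : ℝ)) * ((m : ℝ) ^ k * Real.sqrt m) =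
          B * ((((d * m : ℕ)) : ℝ) ^ (-(1 / 2 : ℝ)) * Real.sqrt m) * (m : ℝ) ^ k by ring, hprod]

/-- **Size of the mollifier-side table**: `‖x_{d₁m₁} x_{d₂m₂} (√m₁)^{2k+1}(√m₂)^{2k+1}‖ ≤ B² (d₁d₂)^{−1/2} (m₁m₂)^k`.
[cite: KowalskiMichelVanderKam2000, (8)–(9)] -/
theorem norm_mollifierPair_le {P : ℝ[X]} {B : ℝ} (hB : ∀ t ∈ Set.Icc (0 : ℝ) 1, |P.eval t| ≤ B)
    {M : ℝ} (hM : 1 < M) {d₁ d₂ m₁ m₂ : ℕ} (hd₁ : 0 < d₁) (hd₂ : 0 < d₂) (hm₁ : 0 < m₁) (hm₂ : 0 < m₂)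
    (h₁ : d₁ * m₁ ≤ ⌊M⌋₊) (h₂ : d₂ * m₂ ≤ ⌊M⌋₊) (k : ℕ) :
    ‖(KMV2000.mollifierCoeff P M (d₁ * m₁) : ℂ) * (KMV2000.mollifierCoeff P M (d₂ * m₂) : ℂ) *
        ((Real.sqrt m₁ ^ (2 * k + 1) * Real.sqrt m₂ ^ (2 * k + 1) : ℝ) : ℂ)‖ ≤
      B ^ 2 * ((d₁ : ℝ) ^ (-(1 / 2 : ℝ)) * (d₂ : ℝ) ^ (-(1 / 2 : ℝ))) * ((m₁ : ℝ) ^ k * (m₂ : ℝ) ^ k) := by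
  have hB0 : 0 ≤ B := le_trans (abs_nonneg _) (hB 0 (by simp))
  rw [norm_mul, norm_mul, Complex.norm_real, Complex.norm_real, Complex.norm_real, Real.norm_eq_abs, Real.norm_eq_abs,
    Real.norm_eq_abs, abs_mul, abs_of_nonneg (pow_nonneg (Real.sqrt_nonneg _) _),
    abs_of_nonneg (pow_nonneg (Real.sqrt_nonneg _) _)]
  have e : |KMV2000.mollifierCoeff P M (d₁ * m₁)| * |KMV2000.mollifierCoeff P M (d₂ * m₂)| *
      (Real.sqrt m₁ ^ (2 * k + 1) * Real.sqrt m₂ ^ (2 * k + 1)) =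
      (|KMV2000.mollifierCoeff P M (d₁ * m₁)| * Real.sqrt m₁ ^ (2 * k + 1)) *
        (|KMV2000.mollifierCoeff P M (d₂ * m₂)| * Real.sqrt m₂ ^ (2 * k + 1)) := by ring
  rw [e]
  have a₁ := abs_mollifierCoeff_mul_sqrt_pow_le hB hM hd₁ hm₁ h₁ k
  have a₂ := abs_mollifierCoeff_mul_sqrt_pow_le hB hM hd₂ hm₂ h₂ k
  have n₁ : 0 ≤ |KMV2000.mollifierCoeff P M (d₁ * m₁)| * Real.sqrt m₁ ^ (2 * k + 1) := by positivity
  have n₂ : 0 ≤ |KMV2000.mollifierCoeff P M (d₂ * m₂)| * Real.sqrt m₂ ^ (2 * k + 1) := by positivity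
  calc (|KMV2000.mollifierCoeff P M (d₁ * m₁)| * Real.sqrt m₁ ^ (2 * k + 1)) *
        (|KMV2000.mollifierCoeff P M (d₂ * m₂)| * Real.sqrt m₂ ^ (2 * k + 1))
      ≤ (B * (d₁ : ℝ) ^ (-(1 / 2 : ℝ)) * (m₁ : ℝ) ^ k) * (B * (d₂ : ℝ) ^ (-(1 / 2 : ℝ)) * (m₂ : ℝ) ^ k) :=
        mul_le_mul a₁ a₂ n₂ (le_trans n₁ a₁)
    _ = B ^ 2 * ((d₁ : ℝ) ^ (-(1 / 2 : ℝ)) * (d₂ : ℝ) ^ (-(1 / 2 : ℝ))) * ((m₁ : ℝ) ^ k * (m₂ : ℝ) ^ k) := by ring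

/-- **`ℓ²(box)` bound for the mollifier-side table**: for `d₁X₁, d₂X₂ ≤ ⌊M⌋`,
`Σ_{m₁≤X₁, m₂≤X₂} ‖x_{d₁m₁}x_{d₂m₂}(√m₁)^{2k+1}(√m₂)^{2k+1}‖² ≤ B⁴ (d₁d₂)⁻¹ X₁^{2k+1} X₂^{2k+1}`.
[cite: KowalskiMichelVanderKam2000, (8)–(9)] -/
theorem norm_sq_sum_mollifierPair_le {P : ℝ[X]} {B : ℝ} (hB : ∀ t ∈ Set.Icc (0 : ℝ) 1, |P.eval t| ≤ B)
    {M : ℝ} (hM : 1 < M) {d₁ d₂ X₁ X₂ : ℕ} (hd₁ : 0 < d₁) (hd₂ : 0 < d₂)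
    (h₁ : d₁ * X₁ ≤ ⌊M⌋₊) (h₂ : d₂ * X₂ ≤ ⌊M⌋₊) (k : ℕ) :
    ∑ p ∈ Icc 1 X₁ ×ˢ Icc 1 X₂,
        ‖(KMV2000.mollifierCoeff P M (d₁ * p.1) : ℂ) * (KMV2000.mollifierCoeff P M (d₂ * p.2) : ℂ) *
          ((Real.sqrt p.1 ^ (2 * k + 1) * Real.sqrt p.2 ^ (2 * k + 1) : ℝ) : ℂ)‖ ^ 2 ≤
      B ^ 4 * ((d₁ : ℝ) * d₂)⁻¹ * ((X₁ : ℝ) ^ (2 * k + 1) * (X₂ : ℝ) ^ (2 * k + 1)) := by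
  have hB0 : 0 ≤ B := le_trans (abs_nonneg _) (hB 0 (by simp))
  have hd₁0 : (0 : ℝ) < d₁ := by exact_mod_cast hd₁
  have hd₂0 : (0 : ℝ) < d₂ := by exact_mod_cast hd₂
  -- termwise bound by the constant `B² (d₁d₂)^{-1/2} X₁^k X₂^k`
  set Cst : ℝ := B ^ 2 * ((d₁ : ℝ) ^ (-(1 / 2 : ℝ)) * (d₂ : ℝ) ^ (-(1 / 2 : ℝ))) * ((X₁ : ℝ) ^ k * (X₂ : ℝ) ^ k) with hCst
  have hCst0 : 0 ≤ Cst := by positivity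
  have hterm : ∀ p ∈ Icc 1 X₁ ×ˢ Icc 1 X₂,
      ‖(KMV2000.mollifierCoeff P M (d₁ * p.1) : ℂ) * (KMV2000.mollifierCoeff P M (d₂ * p.2) : ℂ) *
          ((Real.sqrt p.1 ^ (2 * k + 1) * Real.sqrt p.2 ^ (2 * k + 1) : ℝ) : ℂ)‖ ^ 2 ≤ Cst ^ 2 := by
    intro p hp
    simp only [mem_product, mem_Icc] at hp
    have hm₁ : 0 < p.1 := hp.1.1
    have hm₂ : 0 < p.2 := hp.2.1
    have hle := norm_mollifierPair_le hB hM hd₁ hd₂ hm₁ hm₂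
      (le_trans (Nat.mul_le_mul_left _ hp.1.2) h₁) (le_trans (Nat.mul_le_mul_left _ hp.2.2) h₂) k
    have hmono : B ^ 2 * ((d₁ : ℝ) ^ (-(1 / 2 : ℝ)) * (d₂ : ℝ) ^ (-(1 / 2 : ℝ))) * ((p.1 : ℝ) ^ k * (p.2 : ℝ) ^ k) ≤ Cst := by
      rw [hCst]
      refine mul_le_mul_of_nonneg_left ?_ (by positivity)
      exact mul_le_mul (pow_le_pow_left₀ (Nat.cast_nonneg _) (by exact_mod_cast hp.1.2) k)
        (pow_le_pow_left₀ (Nat.cast_nonneg _) (by exact_mod_cast hp.2.2) k) (by positivity) (by positivity)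
    exact pow_le_pow_left₀ (norm_nonneg _) (hle.trans hmono) 2
  refine (Finset.sum_le_sum hterm).trans ?_
  rw [Finset.sum_const, Finset.card_product, Nat.card_Icc, Nat.card_Icc, nsmul_eq_mul]
  simp only [Nat.add_sub_cancel]
  rw [hCst]
  -- `X₁X₂ · (B² (d₁d₂)^{-1/2} X₁^k X₂^k)² = B⁴ (d₁d₂)⁻¹ X₁^{2k+1} X₂^{2k+1}`
  have hd : ((d₁ : ℝ) ^ (-(1 / 2 : ℝ)) * (d₂ : ℝ) ^ (-(1 / 2 : ℝ))) ^ 2 = ((d₁ : ℝ) * d₂)⁻¹ := by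
    rw [mul_pow, ← Real.rpow_natCast ((d₁ : ℝ) ^ (-(1 / 2 : ℝ))), ← Real.rpow_natCast ((d₂ : ℝ) ^ (-(1 / 2 : ℝ))),
      ← Real.rpow_mul hd₁0.le, ← Real.rpow_mul hd₂0.le]
    norm_num
    rw [Real.rpow_neg_one, Real.rpow_neg_one, mul_comm]
  push_cast
  rw [show (B ^ 2 * ((d₁ : ℝ) ^ (-(1 / 2 : ℝ)) * (d₂ : ℝ) ^ (-(1 / 2 : ℝ))) * ((X₁ : ℝ) ^ k * (X₂ : ℝ) ^ k)) ^ 2 =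
      B ^ 4 * (((d₁ : ℝ) ^ (-(1 / 2 : ℝ)) * (d₂ : ℝ) ^ (-(1 / 2 : ℝ))) ^ 2) * ((X₁ : ℝ) ^ (2 * k) * (X₂ : ℝ) ^ (2 * k)) by ring,
    hd]
  have : (X₁ : ℝ) * X₂ * (B ^ 4 * ((d₁ : ℝ) * d₂)⁻¹ * ((X₁ : ℝ) ^ (2 * k) * (X₂ : ℝ) ^ (2 * k))) =
      B ^ 4 * ((d₁ : ℝ) * d₂)⁻¹ * ((X₁ : ℝ) ^ (2 * k + 1) * (X₂ : ℝ) ^ (2 * k + 1)) := by ring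
  rw [this]

end Summit.Parity.GeneralizedHardyLittlewood.Theorems.MomentsBeyondDiagonal.Layers

end
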